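import Summits.ValiantsHypothesis.ValiantsHypothesis.Theorems.TwoAdicLadderTwoIntegralNormalisationLocalPoints
import Summits.ValiantsHypothesis.ValiantsHypothesis.Theorems.TwoAdicLadderTwoIntegralNormalisationDivisionForm
import Summits.ValiantsHypothesis.ValiantsHypothesis.Theorems.TwoAdicLadderLadderOfVHTransfer
import Literature.Computability.AlgebraicComplexity.StandardFamiliesProofs
import Literature.Computability.AlgebraicComplexity.RazElusiveGeneralProofs

/-!
# TwoAdicLadder — crux `TwoIntegralNormalisation` (stmt-ValiantsHypothesis-5947), line `birth`,
# stub `stub_halfElim`: PRECISION-UNIFORM = EXACT — the crux IS the exact-division statement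

Route `ValiantsHypothesis/TwoAdicLadder`, crux `TwoIntegralNormalisation` (TIN). The tree already
has `HalfElimGlobal → TIN` (`twoIntegralNormalisation_of_halfElimGlobal'`) and
`DivElimGlobal ↔ HalfElimGlobal` (`divElimGlobal_iff_halfElimGlobal`). This file proves the
CONVERSE `TIN → HalfElimGlobal`, unconditionally, so that

  **`TwoIntegralNormalisation ↔ HalfElimGlobal ↔ DivElimGlobal`**
  (`twoIntegralNormalisation_iff_halfElimGlobal`, `twoIntegralNormalisation_iff_divElimGlobal`):

the crux is EXACTLY the statement "if the scaled permanents `2^{M_n} · per_n` have polynomial-size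
circuits over `2`-adically integral number rings then so do the permanents `per_n`, eventually" —
exact division by a power of `2` at polynomial cost, with no reference to finite rings, precisions
`k`, or the `2`-adic height of constants.

The new direction is a transfer principle in the spirit of `LadderOfVH`
(`…LadderOfVHTransfer.lean`), with the Nullstellensatz step replaced by ARITHMETIC SPECIALISATION:

* `exists_localization_solution_of_twoAdic` — an integer polynomial system solvable in commutative
  rings `R₀, R₁, …` with `2` nilpotent in each `R_k` and `2^k ≠ 0` in `R_k` is solvable in
  `Localization.AtPrime P'` for some prime `P' ∋ 2` of the ring of integers of some number field:
  solve it in `A = Π R_k`; `2` lies in the Jacobson radical of `A` (`1 − 2a` is a unit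
  coordinatewise) and its powers are non-zero, so modulo a prime `P` avoiding `2^ℕ` the solution
  lives in a domain of characteristic `0` in which `2` is NOT a unit; the `ℤ`-subalgebra generated
  by the solution is then a finitely generated `ℤ`-domain with `2` a non-unit, which maps to some
  `𝓞_(P')` (`exists_ringHom_localizationAtPrime`, `…LocalPoints.lean`: Noether coordinates of the
  fibre, Zariski's Main Theorem, going down).
* `complexity_perPoly_localization_le_of_twoAdic` — with Raz's integer universal circuit
  (`RazUniversal.exists_universalCircuit_int`, as in `complexity_map_complex_le_of_twoAdic`):
  if `L_{R_k}(per_n) ≤ s` for all `k` then `L_{𝓞_(P')}(per_n) ≤ 21877 · (n² + n + s + 2)²⁶` for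
  some `𝓞_(P')`, `P' ∋ 2`, of some number field.
* `halfElimGlobal_of_twoIntegralNormalisation` and the two `iff`s.

Honest framing: this settles the SHAPE of the crux (its reshaped stub is lossless), not the crux;
`stub_halfElim`, `DivElim(Global)`, the crux and VP ≠ VNP are NOT proved here.
-/

noncomputable section

open MvPolynomial

-- the summit and the problem share the name `ValiantsHypothesis` (D-0017 single-conjunct layout)
set_option linter.dupNamespace false

namespace Summit.ValiantsHypothesis.ValiantsHypothesis.Theorems.TwoAdicLadder.TwoIntegralNormalisation

open Summit.ValiantsHypothesis.ValiantsHypothesis.Theses.TwoAdicLadder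
open Summit.ValiantsHypothesis.ValiantsHypothesis.Theorems.TwoAdicLadder
open NumberField Literature.Computability.AlgebraicComplexity Filter

/-! ### Systems: from `2`-adically deep rings to a `2`-integral number ring -/

/-- Where `2` is nilpotent, `1 - 2a` is a unit for every `a` (`2` lies in the Jacobson radical).
[folklore] -/
theorem isUnit_one_sub_two_mul_of_isNilpotent_two {B : Type*} [CommRing B]
    (h2 : IsNilpotent (2 : B)) (a : B) : IsUnit (1 - 2 * a) := by
  obtain ⟨N, hN⟩ := h2
  have hn : IsNilpotent (2 * a) := ⟨N, by rw [mul_pow, hN, zero_mul]⟩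
  exact IsNilpotent.isUnit_one_sub hn

/-- **Transfer of solvability, `2`-adically deep rings ⇒ a `2`-integral number ring.** An integer
polynomial system solvable in commutative rings `R₀, R₁, …` with `2` nilpotent in every `R_k` and
`2^k ≠ 0` in `R_k` is solvable in `Localization.AtPrime P'` for some prime ideal `P' ∋ 2` of the
ring of integers of some number field `K'`. (Product ring, a prime avoiding `2^ℕ` — modulo which
`2` is a non-zero non-unit since `2` is in the Jacobson radical of the product — and arithmetic
specialisation of the finitely generated `ℤ`-domain generated by the solution,
`exists_ringHom_localizationAtPrime`.) [folklore] -/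
theorem exists_localization_solution_of_twoAdic {m s : ℕ} (S : Fin s → MvPolynomial (Fin m) ℤ)
    (R : ℕ → Type) [∀ k, CommRing (R k)] (h2 : ∀ k, IsNilpotent (2 : R k))
    (hk : ∀ k, (2 : R k) ^ k ≠ 0)
    (hsol : ∀ k, ∃ z : Fin m → R k, ∀ i, eval₂ (Int.castRingHom (R k)) z (S i) = 0) :
    ∃ (K : Type) (_ : Field K) (_ : NumberField K) (P : Ideal (𝓞 K)) (_ : P.IsPrime),
      (2 : 𝓞 K) ∈ P ∧
      ∃ z : Fin m → Localization.AtPrime P,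
        ∀ i, eval₂ (Int.castRingHom (Localization.AtPrime P)) z (S i) = 0 := by
  classical
  choose z hz using hsol
  -- the product solution in the product ring `Π R_k`
  let zA : Fin m → (∀ k, R k) := fun j k => z k j
  have hzA : ∀ i, eval₂ (Int.castRingHom (∀ k, R k)) zA (S i) = 0 := by
    intro i
    funext k
    have h := ringHom_eval₂_int (Pi.evalRingHom R k) zA (S i)
    rw [Pi.evalRingHom_apply] at h
    rw [Pi.zero_apply, h]
    exact hz k i
  -- the powers of `2` are non-zero in `Π R_k`
  have hpow : ∀ j, (2 : ∀ k, R k) ^ j ≠ 0 := by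
    intro j h
    apply hk j
    have := congrFun h j
    simpa using this
  have hdisj : Disjoint ((⊥ : Ideal (∀ k, R k)) : Set (∀ k, R k))
      (Submonoid.powers (2 : ∀ k, R k)) := by
    refine Set.disjoint_left.mpr ?_
    rintro x hx ⟨j, rfl⟩
    simp only [SetLike.mem_coe, Ideal.mem_bot] at hx
    exact hpow j hx
  obtain ⟨P, hP, -, hPdisj⟩ :=
    Ideal.exists_le_prime_disjoint (⊥ : Ideal (∀ k, R k)) (Submonoid.powers 2) hdisj
  -- `D = (Π R_k) ⧸ P` is a domain of characteristic zero in which `2` is not a unit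
  have h2Q : ∀ j, (2 : (∀ k, R k) ⧸ P) ^ j ≠ 0 := by
    intro j h
    have hmem : (2 : ∀ k, R k) ^ j ∈ P := by
      rw [← Ideal.Quotient.eq_zero_iff_mem, map_pow, map_ofNat]
      exact h
    exact Set.disjoint_left.mp hPdisj hmem ⟨j, rfl⟩
  have hoddQ : ∀ q : ℕ, Odd q → (q : (∀ k, R k) ⧸ P) ≠ 0 := by
    intro q hq h
    have hu : IsUnit (q : ∀ k, R k) := by
      refine Pi.isUnit_iff.mpr fun k => ?_
      rw [Pi.natCast_apply]
      exact isUnit_natCast_of_odd_of_isNilpotent_two (h2 k) hq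
    have hmem : (q : ∀ k, R k) ∈ P := by
      rw [← Ideal.Quotient.eq_zero_iff_mem, map_natCast]
      exact h
    exact hP.ne_top (P.eq_top_of_isUnit_mem hmem hu)
  haveI : CharZero ((∀ k, R k) ⧸ P) := by
    refine charZero_of_inj_zero fun q hq => ?_
    by_contra hq0
    obtain ⟨a, b, hb, rfl⟩ := Nat.exists_eq_two_pow_mul_odd hq0
    rw [Nat.cast_mul, Nat.cast_pow, Nat.cast_ofNat] at hq
    rcases mul_eq_zero.mp hq with h | h
    · exact h2Q a h
    · exact hoddQ b hb h
  have h2D : ¬ IsUnit (2 : (∀ k, R k) ⧸ P) := by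
    rintro ⟨u, hu⟩
    obtain ⟨a, ha⟩ := Ideal.Quotient.mk_surjective (u⁻¹ : ((∀ k, R k) ⧸ P)ˣ).val
    have hunit : IsUnit (1 - 2 * a : ∀ k, R k) :=
      Pi.isUnit_iff.mpr fun k => by
        simpa using isUnit_one_sub_two_mul_of_isNilpotent_two (h2 k) (a k)
    have hmem : (1 - 2 * a : ∀ k, R k) ∈ P := by
      rw [← Ideal.Quotient.eq_zero_iff_mem, map_sub, map_one, map_mul, map_ofNat, ha, ← hu,
        Units.mul_inv, sub_self]
    exact hP.ne_top (P.eq_top_of_isUnit_mem hmem hunit)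
  -- the finitely generated `ℤ`-subalgebra generated by the solution
  let π : (∀ k, R k) →+* (∀ k, R k) ⧸ P := Ideal.Quotient.mk P
  let Bs : Subalgebra ℤ ((∀ k, R k) ⧸ P) := Algebra.adjoin ℤ (Set.range fun j => π (zA j))
  have hBsfg : Bs.FG := Subalgebra.fg_def.2 ⟨_, Set.finite_range _, rfl⟩
  have hft : Algebra.FiniteType ℤ Bs := ⟨(Subalgebra.fg_top _).2 hBsfg⟩
  have h2B : ¬ IsUnit (2 : Bs) := fun h => h2D (by
    have h' := h.map Bs.val
    rwa [map_ofNat] at h')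
  -- (the `ℤ`-algebra structures `algebraInt` and `Subalgebra.algebra` agree: `Algebra ℤ _` is a
  -- subsingleton)
  have hft' : @Algebra.FiniteType ℤ Bs _ _ (Ring.toIntAlgebra Bs) := by
    have e : (Bs.algebra : Algebra ℤ Bs) = Ring.toIntAlgebra Bs := Subsingleton.elim _ _
    rw [← e]; exact hft
  obtain ⟨K, hF, hNF, P', hP', h2P', ⟨ψ⟩⟩ :=
    @exists_ringHom_localizationAtPrime Bs _ _ _ hft' h2B
  refine ⟨K, hF, hNF, P', hP', h2P', fun j => ψ ⟨π (zA j), Algebra.subset_adjoin ⟨j, rfl⟩⟩, ?_⟩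
  intro i
  have hBi : eval₂ (Int.castRingHom Bs) (fun j => (⟨π (zA j), Algebra.subset_adjoin ⟨j, rfl⟩⟩ : Bs))
      (S i) = 0 := by
    apply Subtype.ext
    have h := ringHom_eval₂_int Bs.val.toRingHom
      (fun j => (⟨π (zA j), Algebra.subset_adjoin ⟨j, rfl⟩⟩ : Bs)) (S i)
    simp only [AlgHom.toRingHom_eq_coe, RingHom.coe_coe, Subalgebra.coe_val] at h
    rw [h]
    have h' := ringHom_eval₂_int π zA (S i)
    rw [hzA, map_zero] at h'
    simpa using h'.symm
  have h := ringHom_eval₂_int ψ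
    (fun j => (⟨π (zA j), Algebra.subset_adjoin ⟨j, rfl⟩⟩ : Bs)) (S i)
  rw [hBi, map_zero] at h
  exact h.symm

/-! ### The complexity transfer to a `2`-integral number ring -/

/-- **Small circuits over `2`-adically deep rings give a small circuit over a `2`-integral number
ring.** If an integer polynomial `f₀ ∈ ℤ[x₁,…,x_N]` has fan-in-two circuits of size `≤ s` over
commutative rings `R₀, R₁, …` with `2` nilpotent in every `R_k` and `2^k ≠ 0` in `R_k`, then
`L_{𝓞_(P')}(f₀) ≤ 21877 · (N + deg f₀ + s + 2)²⁶` over the local ring at some prime `P' ∋ 2` of the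
ring of integers of some number field (Raz's integer universal circuit turns "small circuit" into an
integer system; `exists_localization_solution_of_twoAdic`). [cite: Raz2010, Prop. 3.3] -/
theorem complexity_map_localization_le_of_twoAdic {N : ℕ} (f₀ : MvPolynomial (Fin N) ℤ) (s : ℕ)
    (R : ℕ → Type) [∀ k, CommRing (R k)] (h2 : ∀ k, IsNilpotent (2 : R k))
    (hk : ∀ k, (2 : R k) ^ k ≠ 0)
    (hc : ∀ k, complexity (MvPolynomial.map (Int.castRingHom (R k)) f₀) ≤ s) :
    ∃ (K : Type) (_ : Field K) (_ : NumberField K) (P : Ideal (𝓞 K)) (_ : P.IsPrime),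
      (2 : 𝓞 K) ∈ P ∧
      complexity (MvPolynomial.map (Int.castRingHom (Localization.AtPrime P)) f₀) ≤
        21877 * (N + f₀.totalDegree + s + 2) ^ 26 := by
  classical
  obtain ⟨p, U, -, hU, -, -, huniv⟩ :=
    RazUniversal.exists_universalCircuit_int.{0} N s f₀.totalDegree
  -- the integer system
  set V := sumAlgEquiv ℤ (Fin N) (Fin p) U with hV
  let M : Finset (Fin N →₀ ℕ) := V.support ∪ f₀.support
  let E : (Fin N →₀ ℕ) → MvPolynomial (Fin p) ℤ := fun m => coeff m V - C (coeff m f₀)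
  let Sys : Fin M.card → MvPolynomial (Fin p) ℤ := fun i => E (M.equivFin.symm i)
  -- solvable in every `R k`
  have hsol : ∀ k, ∃ z : Fin p → R k, ∀ i, eval₂ (Int.castRingHom (R k)) z (Sys i) = 0 := by
    intro k
    obtain ⟨α, hα⟩ := huniv (R k) (MvPolynomial.map (Int.castRingHom (R k)) f₀)
      (totalDegree_map_le_int f₀) (hc k)
    refine ⟨α, fun i => ?_⟩
    have h := (aeval_universal_eq_iff U f₀ α).mp hα (M.equivFin.symm i)
    rw [aeval_eq_eval₂_int] at h
    exact h
  -- hence solvable over some `𝓞_(P')`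
  obtain ⟨K, hF, hNF, P', hP', h2P', ζ, hζ⟩ :=
    exists_localization_solution_of_twoAdic Sys R h2 hk hsol
  refine ⟨K, hF, hNF, P', hP', h2P', ?_⟩
  have hspec : aeval (Sum.elim X fun j => C (ζ j))
      (MvPolynomial.map (Int.castRingHom (Localization.AtPrime P')) U) =
      MvPolynomial.map (Int.castRingHom (Localization.AtPrime P')) f₀ := by
    refine (aeval_universal_eq_iff U f₀ ζ).mpr fun m => ?_
    by_cases hm : m ∈ M
    · have := hζ (M.equivFin ⟨m, hm⟩)
      rw [aeval_eq_eval₂_int, ← hV]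
      simpa [Sys, E] using this
    · rw [← hV, universal_eq_trivial U f₀ (by simpa [M] using hm), map_zero]
  -- projections and extension of scalars are free
  have hproj : IsProjection (MvPolynomial.map (Int.castRingHom (Localization.AtPrime P')) f₀)
      (MvPolynomial.map (Int.castRingHom (Localization.AtPrime P')) U) := by
    refine ⟨Sum.elim X fun j => C (ζ j), fun i => ?_, hspec.symm⟩
    rcases i with i | j
    · exact Or.inl ⟨i, rfl⟩
    · exact Or.inr ⟨ζ j, rfl⟩
  calc complexity (MvPolynomial.map (Int.castRingHom (Localization.AtPrime P')) f₀)
      ≤ complexity (MvPolynomial.map (Int.castRingHom (Localization.AtPrime P')) U) :=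
        complexity_le_of_isProjection hproj
    _ ≤ complexity U := ArithCircuit.complexity_map_le _ _
    _ ≤ 21877 * (N + f₀.totalDegree + s + 2) ^ 26 := hU

/-- **Per-`n` transfer for the permanent.** If for every precision `k` some commutative ring `R_k`
with `2` nilpotent and `2^k ≠ 0` has `L_{R_k}(per_n) ≤ s`, then
`L_{𝓞_(P')}(per_n) ≤ 21877 · (n² + n + s + 2)²⁶` over the local ring at some prime `P' ∋ 2` of
some number field: precision-uniform small circuits over finite `2`-adic rings give ONE exact
small circuit over a `2`-adically integral number ring. [folklore] -/
theorem complexity_perPoly_localization_le_of_twoAdic (n s : ℕ) (R : ℕ → Type)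
    [∀ k, CommRing (R k)] (h2 : ∀ k, IsNilpotent (2 : R k)) (hk : ∀ k, (2 : R k) ^ k ≠ 0)
    (hc : ∀ k, complexity (perPoly (Fin n) (R k)) ≤ s) :
    ∃ (K : Type) (_ : Field K) (_ : NumberField K) (P : Ideal (𝓞 K)) (_ : P.IsPrime),
      (2 : 𝓞 K) ∈ P ∧
      complexity (perPoly (Fin n) (Localization.AtPrime P)) ≤ 21877 * (n * n + n + s + 2) ^ 26 := by
  classical
  let e : Fin n × Fin n ≃ Fin (n * n) := finProdFinEquiv
  let f₀ : MvPolynomial (Fin (n * n)) ℤ := rename e (perPoly (Fin n) ℤ)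
  have hmap : ∀ (B : Type) [CommRing B],
      MvPolynomial.map (Int.castRingHom B) f₀ = rename e (perPoly (Fin n) B) := by
    intro B _
    simp only [f₀, map_rename, map_perPoly]
  have hdeg : f₀.totalDegree ≤ n := by
    refine (totalDegree_rename_le _ _).trans ?_
    rw [totalDegree_perPoly_holds, Fintype.card_fin]
  have hcR : ∀ k, complexity (MvPolynomial.map (Int.castRingHom (R k)) f₀) ≤ s := by
    intro k
    rw [hmap, complexity_rename_of_injective_holds e.injective]
    exact hc k
  obtain ⟨K, hF, hNF, P', hP', h2P', h⟩ := complexity_map_localization_le_of_twoAdic f₀ s R h2 hk hcR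
  refine ⟨K, hF, hNF, P', hP', h2P', ?_⟩
  rw [hmap, complexity_rename_of_injective_holds e.injective] at h
  refine h.trans ?_
  gcongr

/-! ### The crux is the global exact-division statement -/

/-- Envelope: for `n ≥ 2`, `n^c + c ≤ n^(c+3)`. [folklore] -/
theorem pow_add_le_pow (c n : ℕ) (hn : 2 ≤ n) : n ^ c + c ≤ n ^ (c + 3) :=
  le_trans (by omega) (envelope_bound c n hn)

/-- **`TwoIntegralNormalisation → HalfElimGlobal`** (the converse of the landed
`twoIntegralNormalisation_of_halfElimGlobal'`). Given the crux and polynomial-size circuits for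
`per` over number fields (the hypothesis of `HalfElimGlobal`), the permanent is p-computable over
`ℂ`, so the crux provides ONE exponent `a` and, for all large `n` and EVERY precision `k`, an
admissible ring `R_{n,k}` with `L(per_n) ≤ n^a`; the transfer
`complexity_perPoly_localization_le_of_twoAdic` turns these into ONE circuit of size
`≤ 21877 (n² + n + n^a + 2)²⁶ ≤ n^b` over some `𝓞_(P')`, `P' ∋ 2`, of some number field — the
conclusion of `HalfElimGlobal`. [folklore] -/
theorem halfElimGlobal_of_twoIntegralNormalisation (hT : TwoIntegralNormalisation) :
    (∃ a : ℕ, ∀ n : ℕ, ∃ (K : Type) (_ : Field K) (_ : NumberField K),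
        complexity (perPoly (Fin n) K) ≤ n ^ a + a) →
      ∃ b : ℕ, ∀ᶠ n in Filter.atTop, ∃ (K' : Type) (_ : Field K') (_ : NumberField K')
        (P : Ideal (𝓞 K')) (_ : P.IsPrime), (2 : 𝓞 K') ∈ P ∧
        complexity (perPoly (Fin n) (Localization.AtPrime P)) ≤ n ^ b := by
  intro hK
  obtain ⟨a, ha⟩ := hT (isPComputable_perPoly_complex_of_numberField hK)
  -- a polynomial envelope for the transfer bound
  let q : Polynomial ℕ :=
    21877 * (Polynomial.X * Polynomial.X + Polynomial.X + Polynomial.X ^ a + 2) ^ 26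
  have hq : IsPBounded fun n => 21877 * (n * n + n + n ^ a + 2) ^ 26 :=
    (isPBounded_iff_exists_polynomial_holds _).2 ⟨q, fun n => by simp [q]⟩
  obtain ⟨c, hc⟩ := hq
  refine ⟨c + 3, ?_⟩
  filter_upwards [ha, Filter.eventually_ge_atTop 2] with n hn hn2
  choose Rn instR _instF _hPIR h2 hk hcx using hn
  obtain ⟨K', hF, hNF, P', hP', h2P', hle⟩ :=
    @complexity_perPoly_localization_le_of_twoAdic n (n ^ a) Rn instR h2 hk hcx
  refine ⟨K', hF, hNF, P', hP', h2P', hle.trans ?_⟩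
  exact (hc n).trans (pow_add_le_pow c n hn2)

/-- **`TwoIntegralNormalisation ↔ HalfElimGlobal`**: the crux is EQUIVALENT to the global form of
`1/2`-elimination for the permanent (`→`: `halfElimGlobal_of_twoIntegralNormalisation`; `←`: the
landed `twoIntegralNormalisation_of_halfElimGlobal'`). [folklore] -/
theorem twoIntegralNormalisation_iff_halfElimGlobal :
    TwoIntegralNormalisation ↔
    ((∃ a : ℕ, ∀ n : ℕ, ∃ (K : Type) (_ : Field K) (_ : NumberField K),
        complexity (perPoly (Fin n) K) ≤ n ^ a + a) →
      ∃ b : ℕ, ∀ᶠ n in Filter.atTop, ∃ (K' : Type) (_ : Field K') (_ : NumberField K')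
        (P : Ideal (𝓞 K')) (_ : P.IsPrime), (2 : 𝓞 K') ∈ P ∧
        complexity (perPoly (Fin n) (Localization.AtPrime P)) ≤ n ^ b) :=
  ⟨halfElimGlobal_of_twoIntegralNormalisation, twoIntegralNormalisation_of_halfElimGlobal'⟩

/-- **`TwoIntegralNormalisation ↔ DivElimGlobal`**: the crux is EQUIVALENT to the global
exact-division statement for the permanent over `2`-adically integral number rings — "if for one
exponent and every `n` some scaled permanent `2^M · per_n` has polynomial-size circuits over some
`𝓞_(𝔭)`, `𝔭 ∋ 2`, of some number field, then for all large `n` so does `per_n` itself". The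
`2`-adic height of constants, finite rings and precisions have all disappeared from the statement.
[folklore] -/
theorem twoIntegralNormalisation_iff_divElimGlobal :
    TwoIntegralNormalisation ↔
    ((∃ a : ℕ, ∀ n : ℕ, ∃ (K : Type) (_ : Field K) (_ : NumberField K)
        (P : Ideal (𝓞 K)) (_ : P.IsPrime), (2 : 𝓞 K) ∈ P ∧ ∃ M : ℕ,
        complexity (C ((2 : Localization.AtPrime P) ^ M) *
          perPoly (Fin n) (Localization.AtPrime P)) ≤ n ^ a + a) →
      ∃ b : ℕ, ∀ᶠ n in Filter.atTop, ∃ (K' : Type) (_ : Field K') (_ : NumberField K')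
        (P : Ideal (𝓞 K')) (_ : P.IsPrime), (2 : 𝓞 K') ∈ P ∧
        complexity (perPoly (Fin n) (Localization.AtPrime P)) ≤ n ^ b) :=
  twoIntegralNormalisation_iff_halfElimGlobal.trans divElimGlobal_iff_halfElimGlobal.symm

/-- **Precision-uniform = exact, as a standalone equivalence** (no hypothesis on `per` over `ℂ`):
"one exponent `a` such that for all large `n` and every `k` some admissible ring of precision `k`
carries circuits of size `≤ n^a` for `per_n`" holds iff "one exponent `b` such that for all large
`n` some `𝓞_(P')`, `P' ∋ 2`, of some number field carries circuits of size `≤ n^b` for `per_n`".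
(`←`: reduce modulo powers of `P'`, landed `stub_chainRingReduction`; `→`: the transfer.)
[folklore] -/
theorem eventually_admissible_iff_eventually_localization :
    (∃ a : ℕ, ∀ᶠ n in Filter.atTop, ∀ k : ℕ, ∃ (R : Type) (_ : CommRing R) (_ : Fintype R),
        IsPrincipalIdealRing R ∧ IsNilpotent (2 : R) ∧ (2 : R) ^ k ≠ 0 ∧
        complexity (perPoly (Fin n) R) ≤ n ^ a) ↔
    (∃ b : ℕ, ∀ᶠ n in Filter.atTop, ∃ (K' : Type) (_ : Field K') (_ : NumberField K')
        (P : Ideal (𝓞 K')) (_ : P.IsPrime), (2 : 𝓞 K') ∈ P ∧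
        complexity (perPoly (Fin n) (Localization.AtPrime P)) ≤ n ^ b) := by
  constructor
  · rintro ⟨a, ha⟩
    let q : Polynomial ℕ :=
      21877 * (Polynomial.X * Polynomial.X + Polynomial.X + Polynomial.X ^ a + 2) ^ 26
    have hq : IsPBounded fun n => 21877 * (n * n + n + n ^ a + 2) ^ 26 :=
      (isPBounded_iff_exists_polynomial_holds _).2 ⟨q, fun n => by simp [q]⟩
    obtain ⟨c, hc⟩ := hq
    refine ⟨c + 3, ?_⟩
    filter_upwards [ha, Filter.eventually_ge_atTop 2] with n hn hn2
    choose Rn instR _instF _hPIR h2 hk hcx using hn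
    obtain ⟨K', hF, hNF, P', hP', h2P', hle⟩ :=
      @complexity_perPoly_localization_le_of_twoAdic n (n ^ a) Rn instR h2 hk hcx
    refine ⟨K', hF, hNF, P', hP', h2P', hle.trans ?_⟩
    exact (hc n).trans (pow_add_le_pow c n hn2)
  · rintro ⟨b, hb⟩
    refine ⟨b, ?_⟩
    filter_upwards [hb] with n hn
    intro k
    obtain ⟨K', hF, hNF, P, hP, h2P, hle⟩ := hn
    obtain ⟨R, hR, hRf, hPIR, hnil, hne, ⟨φ⟩⟩ := @stub_chainRingReduction K' hF hNF P hP h2P k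
    refine ⟨R, hR, hRf, hPIR, hnil, hne, ?_⟩
    have hmap := ArithCircuit.complexity_map_le φ (perPoly (Fin n) (Localization.AtPrime P))
    rw [map_perPoly] at hmap
    exact hmap.trans hle

end Summit.ValiantsHypothesis.ValiantsHypothesis.Theorems.TwoAdicLadder.TwoIntegralNormalisation

end
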